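import Literature.Computability.FineGrained.SETHHardnessProofs
import Literature.Computability.Cryptography.WordRAMWidth
import HarnessLib

/-!
# Sparsification as a word-RAM SERF reduction: the parser of the sparsifier's output

Infrastructure for the discharge of
`Literature.Computability.FineGrained.kSATInRAMTime_of_sparseKSATInRAMTime_serf`
(`OVFromSETH.lean`; Impagliazzo–Paturi–Zane, JCSS 63 (2001), Thm. 1, Cor. 1–2: `k`-SAT with
parameter `n` SERF-reduces to sparse `k`-SAT). The word-RAM driver of that reduction simulates the
multi-stack sparsifier of `SparsificationAlgorithm.lean` (`TM2Emu.simProgram`), whose output — the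
string `KCNF.encodeList` of the sparse formulas, one symbol code per stack cell, the cells of one
stack lying at a fixed stride `κ` — must then be *parsed back* into the word encoding
`encodeCNFWords` of `FGProblemZoo.lean` expected by the hypothetical sparse-`k`-SAT program. This
file provides that parser as structured word-RAM code (`SProg`, `WordRAMStructured.lean`) with its
semantics, in the style of the forward transcoder `KSatTranscoder.lean`:

* `StreamAt H BOT κ j w` — the code list `w` is read downwards from height `j` of a stack whose
  cell of height `j'` sits at address `BOT + κ j'`;
* the routines `advance` (fetch the next code), `tst` (flag := code ≠ constant), `maxInto`,
  `skipBits` (skip the header numeral), `litP` (one literal: polarity bit, binary digits least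
  significant first, comma ↦ the word `2 · var + polarity`), `clauseP` (one clause ↦ its length word
  and literal words, counting empty clauses), `formulaP` (one formula of the list);
* their semantics (`advance_exec`, …, **`formulaP_exec`**): on a stream holding
  `(ψ.encode ++ [blank]).map cd` for a code map `cd` separating the symbols that occur, `formulaP`
  consumes exactly these codes and appends `KSatTranscoder.clauseWords ψ.clauses` to the output
  region, computing the number of clauses, `CNF.numVars ψ.clauses`, the number of empty clauses and
  the largest word written, within `formulaTime ψ ≤ 19 · (|ψ.encode| + 1)` steps.

[folklore] engineering; encodings of Impagliazzo–Paturi, JCSS 62 (2001), §1 as fixed in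
`FGProblemZoo.lean` / `FineGrainedWave0.lean`.
-/

namespace Literature.Computability.FineGrained.SerfRed

open _root_.Computability Cryptography Cryptography.WordRAM Cryptography.WordRAM.SProg Complexity
  KSatTranscoder

/-! ### Operand shorthands and the register map -/

/-- Direct operand: register / cell `i`. [folklore] -/
abbrev r (i : ℕ) : Operand := .dir i
/-- Indirect operand through cell `i`. [folklore] -/
abbrev pt (i : ℕ) : Operand := .ind i
/-- Immediate operand. [folklore] -/
abbrev im (c : ℕ) : Operand := .imm c

/-! Register map of the parser: `20 = P` (address of the next code), `23 = SYM` (the code just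
fetched), `40 = OUT` (output pointer), `41 = M` (clauses), `42 = NMAX` (`numVars` so far),
`43 = HASE` (empty clauses), `44 = WMAX` (largest word written), `45 = SLOT` (address of the length
word of the current clause), `46 = CNT` (its literals so far), `47 = POL`, `48 = V`, `49 = PW`
(polarity, variable, power of two of the current literal), flags / scratch `50 = T`, `51 = T2`,
`59 = T3`, `62 = T4`, `63 = T5`. -/

/-! ### Streams of codes in stack cells -/

/-- `StreamAt H BOT κ j w`: the codes `w` occupy the stack cells of heights `j, j - 1, …` (cell of
height `j'` at address `BOT + κ * j'`), read top down. [folklore] -/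
def StreamAt (H : ℕ → ℕ) (BOT κ : ℕ) : ℕ → List ℕ → Prop
  | _, [] => True
  | j, c :: w => 1 ≤ j ∧ H (BOT + κ * j) = c ∧ StreamAt H BOT κ (j - 1) w

/-- The empty stream. [folklore] -/
@[simp] theorem streamAt_nil (H : ℕ → ℕ) (BOT κ j : ℕ) : StreamAt H BOT κ j [] := trivial

/-- Unfolding a nonempty stream. [folklore] -/
theorem streamAt_cons {H : ℕ → ℕ} {BOT κ j c : ℕ} {w : List ℕ} :
    StreamAt H BOT κ j (c :: w) ↔ 1 ≤ j ∧ H (BOT + κ * j) = c ∧ StreamAt H BOT κ (j - 1) w :=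
  Iff.rfl

/-- A stream is at most as long as its height. [folklore] -/
theorem StreamAt.length_le {H : ℕ → ℕ} {BOT κ : ℕ} : ∀ {j : ℕ} {w : List ℕ},
    StreamAt H BOT κ j w → w.length ≤ j
  | _, [], _ => Nat.zero_le _
  | j, _ :: w, ⟨hj, _, h⟩ => by
    have := StreamAt.length_le h
    rw [List.length_cons]; omega

/-- Splitting a stream. [folklore] -/
theorem streamAt_append {H : ℕ → ℕ} {BOT κ : ℕ} : ∀ {j : ℕ} {w₁ w₂ : List ℕ},
    StreamAt H BOT κ j (w₁ ++ w₂) ↔ StreamAt H BOT κ j w₁ ∧ StreamAt H BOT κ (j - w₁.length) w₂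
  | j, [], w₂ => by simp
  | j, c :: w₁, w₂ => by
    rw [List.cons_append, streamAt_cons, streamAt_cons, streamAt_append, List.length_cons,
      show j - (w₁.length + 1) = j - 1 - w₁.length by omega]
    tauto

/-- A stream is unaffected by changes to cells off its addresses. [folklore] -/
theorem StreamAt.congr {H H' : ℕ → ℕ} {BOT κ : ℕ} : ∀ {j : ℕ} {w : List ℕ},
    StreamAt H BOT κ j w → (∀ j', 1 ≤ j' → j' ≤ j → H' (BOT + κ * j') = H (BOT + κ * j')) →
    StreamAt H' BOT κ j w
  | _, [], _, _ => trivial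
  | j, c :: w, ⟨hj, hc, h⟩, hH => ⟨hj, by rw [hH j hj le_rfl, hc],
      StreamAt.congr h fun j' h1 h2 => hH j' h1 (by omega)⟩

/-- Streams below an output region are unaffected by the output. [folklore] -/
theorem StreamAt.outMem {G : ℕ → ℕ} {BOT κ j e₀ : ℕ} {w : List ℕ} (h : StreamAt G BOT κ j w)
    (he : BOT + κ * j < e₀) (ys : List ℕ) : StreamAt (outMem G e₀ ys) BOT κ j w :=
  h.congr fun j' _ hj' => outMem_of_lt G ys (by nlinarith)

/-! ### The routines -/

/-- Fetch the next code: `SYM := mem[P]; P -= κ`. [folklore] -/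
def advance (κ : ℕ) : SProg := block [(.div, r 23, pt 20, im 1), (.sub, r 20, r 20, im κ)]

/-- `flag := (SYM ≠ c)`, as `flag := (SYM = c); flag := (flag < 1)`. [folklore] -/
def tst (c flag : ℕ) : SProg := block [(.eq, r flag, r 23, im c), (.lt, r flag, r flag, im 1)]

/-- `dst := max dst src` (scratch flag `s`). [folklore] -/
def maxInto (dst src s : ℕ) : SProg :=
  seq (block [(.lt, r s, r dst, r src)]) (ifz (r s) skip (block [(.div, r dst, r src, im 1)]))

/-- The six symbol codes of the parser. [folklore] -/
structure PCodes where
  /-- code of `Γ'.blank` (end of a formula) -/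
  blank : ℕ
  /-- code of `Γ'.bit false` -/
  b0 : ℕ
  /-- code of `Γ'.bit true` -/
  b1 : ℕ
  /-- code of `Γ'.bra` -/
  bra : ℕ
  /-- code of `Γ'.ket` -/
  ket : ℕ
  /-- code of `Γ'.comma` -/
  comma : ℕ

/-- The code map of a `PCodes`. [folklore] -/
def PCodes.cd (C : PCodes) : Γ' → ℕ
  | .blank => C.blank
  | .bit false => C.b0
  | .bit true => C.b1
  | .bra => C.bra
  | .ket => C.ket
  | .comma => C.comma

/-- The code of `blank`. [folklore] -/
@[simp] theorem PCodes.cd_blank (C : PCodes) : C.cd .blank = C.blank := rfl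
/-- The code of `bit false`. [folklore] -/
@[simp] theorem PCodes.cd_b0 (C : PCodes) : C.cd (.bit false) = C.b0 := rfl
/-- The code of `bit true`. [folklore] -/
@[simp] theorem PCodes.cd_b1 (C : PCodes) : C.cd (.bit true) = C.b1 := rfl
/-- The code of `bra`. [folklore] -/
@[simp] theorem PCodes.cd_bra (C : PCodes) : C.cd .bra = C.bra := rfl
/-- The code of `ket`. [folklore] -/
@[simp] theorem PCodes.cd_ket (C : PCodes) : C.cd .ket = C.ket := rfl
/-- The code of `comma`. [folklore] -/
@[simp] theorem PCodes.cd_comma (C : PCodes) : C.cd .comma = C.comma := rfl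

/-- The largest code. [folklore] -/
def PCodes.sup (C : PCodes) : ℕ := max C.blank (max C.b0 (max C.b1 (max C.bra (max C.ket C.comma))))

/-- Every code is at most `sup`. [folklore] -/
theorem PCodes.cd_le_sup (C : PCodes) (γ : Γ') : C.cd γ ≤ C.sup := by
  rcases γ with _ | ⟨_ | _⟩ | _ | _ | _ <;> simp [PCodes.cd, PCodes.sup]

variable (C : PCodes) (κ : ℕ)

/-- Skip the header numeral: fetch codes up to and including the first comma
(`T := 1; while T { advance; T := (SYM ≠ comma) }`). [folklore] -/
def skipBits : SProg :=
  seq (block [(.band, r 50, im 1, im 1)]) (whilenz (r 50) (seq (advance κ) (tst C.comma 50)))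

/-- The digit loop body of a literal: fetch, test against the comma, and accumulate
`V += [SYM = b1] · PW; PW += PW` (on the comma the increment is `0`). [folklore] -/
def bitBody : SProg :=
  seqs [advance κ, tst C.comma 59, block [(.eq, r 62, r 23, im C.b1), (.mul, r 62, r 62, r 49),
    (.add, r 48, r 48, r 62), (.add, r 49, r 49, r 49)]]

/-- One literal, its polarity code already fetched: polarity, digits (least significant first) up
to the comma, the word `2 V + POL` appended to the output, the literal counter, and the maxima
`NMAX := max NMAX (V + 1)`, `WMAX := max WMAX (2 V + POL)`. [folklore] -/
def litCore : SProg :=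
  seqs [block [(.eq, r 47, r 23, im C.b1), (.band, r 48, im 0, im 0), (.band, r 49, im 1, im 1),
      (.band, r 59, im 1, im 1)],
    whilenz (r 59) (bitBody C κ),
    block [(.add, r 62, r 48, r 48), (.add, r 62, r 62, r 47), (.div, pt 40, r 62, im 1),
      (.add, r 40, r 40, im 1), (.add, r 46, r 46, im 1), (.add, r 63, r 48, im 1)],
    maxInto 42 63 59, maxInto 44 62 59]

/-- The literal loop body of a clause: fetch, test against `ket`, and unless it is the closing
bracket parse a literal. [folklore] -/
def litBody : SProg :=
  seqs [advance κ, tst C.ket 51, ifz (r 51) skip (litCore C κ)]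

/-- One clause, its bracket already fetched: reserve (and zero) the length word, the literals,
back-patch the length, count the clause and — if it is empty — the empty clause, and
`WMAX := max WMAX length`. [folklore] -/
def clauseCore : SProg :=
  seqs [block [(.div, r 45, r 40, im 1), (.band, pt 40, im 0, im 0), (.add, r 40, r 40, im 1),
      (.band, r 46, im 0, im 0), (.band, r 51, im 1, im 1)],
    whilenz (r 51) (litBody C κ),
    block [(.div, pt 45, r 46, im 1), (.add, r 41, r 41, im 1), (.eq, r 59, r 46, im 0),
      (.add, r 43, r 43, r 59)],
    maxInto 44 46 59]

/-- The clause loop body of a formula: fetch, test against `blank`, and unless it is the end of the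
formula parse a clause. [folklore] -/
def clauseBody : SProg :=
  seqs [advance κ, tst C.blank 50, ifz (r 50) skip (clauseCore C κ)]

/-- One formula of the list: skip the header numeral, then the clauses up to and including the
blank. [folklore] -/
def formulaP : SProg :=
  seqs [skipBits C κ, block [(.band, r 50, im 1, im 1)], whilenz (r 50) (clauseBody C κ)]

/-- The parser routines are query-free. [folklore] -/
theorem formulaP_queryFree : (formulaP C κ).QueryFree := by
  simp [formulaP, skipBits, clauseBody, clauseCore, litBody, litCore, bitBody, maxInto, advance,
    tst, seqs, QueryFree, block_queryFree]

variable {C κ}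

/-! ### Semantics of the routines -/

section exec

variable {w : ℕ} {O : List ℕ → List ℕ}

/-- Reading a register operand of a merged memory. [folklore] -/
theorem read_r {S H : ℕ → ℕ} {d : ℕ} (hd : d < 100) : (r d).read (merge S H) = S d :=
  merge_apply_of_lt hd

/-- One cell down is still inside the word. [folklore] -/
theorem addr_pred_lt {BOT κ j w : ℕ} (hw : BOT + κ * j < 2 ^ w) : BOT + κ * (j - 1) < 2 ^ w :=
  lt_of_le_of_lt (Nat.add_le_add_left (Nat.mul_le_mul_left κ (Nat.sub_le j 1)) BOT) hw

/-- **Fetching a code**: `SYM := H (BOT + κ j)`, and the address register moves one cell down.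
[folklore] -/
theorem advance_exec {R H : ℕ → ℕ} {BOT j c : ℕ} (h20 : R 20 = BOT + κ * j) (hj : 1 ≤ j)
    (hBOT : 100 ≤ BOT) (hc : H (BOT + κ * j) = c) (hw : BOT + κ * j < 2 ^ w)
    (qs : List (List ℕ)) :
    Exec w O (advance κ) ⟨merge R H, qs⟩
      ⟨merge (Function.update (Function.update R 23 c) 20 (BOT + κ * (j - 1))) H, qs⟩ 2 := by
  refine Exec.block' _ qs ?_
  have hp : 100 ≤ BOT + κ * j := le_trans hBOT (Nat.le_add_right _ _)
  have hmul : κ * j = κ * (j - 1) + κ := by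
    obtain ⟨j', rfl⟩ := Nat.exists_eq_add_of_le' hj
    simp [Nat.mul_succ]
  have hsub : BOT + κ * j - κ = BOT + κ * (j - 1) := by omega
  simp only [execOps_cons, execOps_nil, execOp, Operand.read, Operand.write,
    merge_apply_of_lt (show 20 < 100 by decide), h20, merge_apply_of_le hp, hc,
    update_merge_of_lt _ _ (show 23 < 100 by decide), update_merge_of_lt _ _ (show 20 < 100 by decide),
    Function.update_of_ne (show (20 : ℕ) ≠ 23 by decide), BinOp.eval_div_one]
  rw [BinOp.eval_sub_of_le (by omega) hw, hsub]

/-- **Testing the code** against a constant: `flag := (SYM ≠ c)`. [folklore] -/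
theorem tst_exec {R H : ℕ → ℕ} {c flag s : ℕ} (hflag : flag < 100) (h23 : R 23 = s)
    (qs : List (List ℕ)) :
    Exec w O (tst c flag) ⟨merge R H, qs⟩
      ⟨merge (Function.update R flag (if s = c then 0 else 1)) H, qs⟩ 2 := by
  refine Exec.block' _ qs ?_
  simp only [execOps_cons, execOps_nil, execOp, Operand.read, Operand.write,
    merge_apply_of_lt (show 23 < 100 by decide), merge_apply_of_lt hflag, h23,
    update_merge_of_lt _ _ hflag, Function.update_self, Function.update_idem, BinOp.eval_eq,
    BinOp.eval_lt]
  congr 2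
  split_ifs <;> simp_all

/-- **The maximum**: `dst := max dst src`, scratch flag `s := (dst < src)`. [folklore] -/
theorem maxInto_exec {R H : ℕ → ℕ} {dst src s : ℕ} (hdst : dst < 100) (hsrc : src < 100)
    (hs : s < 100) (hsd : s ≠ dst) (hss : s ≠ src) (qs : List (List ℕ)) :
    ∃ t, t ≤ 4 ∧ Exec w O (maxInto dst src s) ⟨merge R H, qs⟩
      ⟨merge (Function.update (Function.update R s (if R dst < R src then 1 else 0)) dst
        (max (R dst) (R src))) H, qs⟩ t := by
  have h1 : Exec w O (block [(.lt, r s, r dst, r src)]) ⟨merge R H, qs⟩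
      ⟨merge (Function.update R s (if R dst < R src then 1 else 0)) H, qs⟩ 1 :=
    Exec.block' _ qs (by
      simp only [execOps_cons, execOps_nil, execOp, Operand.read, Operand.write,
        merge_apply_of_lt hdst, merge_apply_of_lt hsrc, update_merge_of_lt _ _ hs, BinOp.eval_lt])
  by_cases hlt : R dst < R src
  · refine ⟨1 + (1 + 2), by omega, h1.seq (Exec.ifz_ne ?_ ?_)⟩
    · simp [Operand.read_dir_merge hs, hlt]
    · refine Exec.block' _ qs ?_
      simp only [execOps_cons, execOps_nil, execOp, Operand.read, Operand.write,
        merge_apply_of_lt hsrc, Function.update_of_ne hss.symm, update_merge_of_lt _ _ hdst,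
        BinOp.eval_div_one, if_pos hlt, max_eq_right hlt.le]
  · refine ⟨1 + (0 + 1), by omega, h1.seq (Exec.ifz_zero ?_ ?_)⟩
    · simp [Operand.read_dir_merge hs, hlt]
    · rw [if_neg hlt, max_eq_left (Nat.le_of_not_lt hlt)]
      have : Function.update (Function.update R s 0) dst (R dst) = Function.update R s 0 := by
        rw [Function.update_eq_iff]
        exact ⟨by rw [Function.update_of_ne hsd.symm], fun _ _ => rfl⟩
      rw [this]
      exact Exec.skip _

/-- The loop of `skipBits`: over the codes of `bs` (none of them the comma) and the comma.
[folklore] -/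
theorem skipLoop_exec {H : ℕ → ℕ} {BOT : ℕ} (hBOT : 100 ≤ BOT) (qs : List (List ℕ)) :
    ∀ (bs : List Bool) (R : ℕ → ℕ) (j : ℕ), R 50 ≠ 0 → R 20 = BOT + κ * j →
      StreamAt H BOT κ j ((bs.map fun b => C.cd (.bit b)) ++ [C.comma]) →
      (∀ b ∈ bs, C.cd (.bit b) ≠ C.comma) → BOT + κ * j < 2 ^ w →
      ∃ (R' : ℕ → ℕ) (t : ℕ), Exec w O (whilenz (r 50) (seq (advance κ) (tst C.comma 50)))
          ⟨merge R H, qs⟩ ⟨merge R' H, qs⟩ t ∧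
        t ≤ 6 * (bs.length + 1) + 1 ∧ R' 20 = BOT + κ * (j - (bs.length + 1)) ∧ R' 23 = C.comma ∧
        R' 50 = 0 ∧ ∀ a, a ≠ 20 → a ≠ 23 → a ≠ 50 → R' a = R a
  | [], R, j, h50, h20, hst, _, hw => by
    simp only [List.map_nil, List.nil_append, streamAt_cons] at hst
    obtain ⟨hj, hc, -⟩ := hst
    have h1 := advance_exec (w := w) (O := O) (κ := κ) h20 hj hBOT hc hw qs
    have h2 := tst_exec (w := w) (O := O) (H := H) (c := C.comma) (flag := 50) (s := C.comma)
      (R := Function.update (Function.update R 23 C.comma) 20 (BOT + κ * (j - 1))) (by decide)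
      (by simp) qs
    rw [if_pos rfl] at h2
    refine ⟨_, 2 + 2 + 1 + 2, Exec.while_ne (by rw [read_r (by decide)]; exact h50) (h1.seq h2)
      (Exec.while_zero (by rw [read_r (by decide)]; simp)), by simp, by simp, by simp, by simp,
      fun a ha hb hc => by simp [ha, hb, hc]⟩
  | b :: bs, R, j, h50, h20, hst, hsep, hw => by
    simp only [List.map_cons, List.cons_append, streamAt_cons] at hst
    obtain ⟨hj, hc, hrest⟩ := hst
    have hne : C.cd (.bit b) ≠ C.comma := hsep b (by simp)
    have h1 := advance_exec (w := w) (O := O) (κ := κ) h20 hj hBOT hc hw qs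
    have h2 := tst_exec (w := w) (O := O) (H := H) (c := C.comma) (flag := 50) (s := C.cd (.bit b))
      (R := Function.update (Function.update R 23 (C.cd (.bit b))) 20 (BOT + κ * (j - 1))) (by decide)
      (by simp) qs
    rw [if_neg hne] at h2
    obtain ⟨R', t, hloop, ht, h20', h23', h50', hR'⟩ := skipLoop_exec hBOT qs bs
      (Function.update (Function.update (Function.update R 23 (C.cd (.bit b))) 20 (BOT + κ * (j - 1)))
        50 1) (j - 1) (by simp) (by simp) hrest (fun b' hb' => hsep b' (by simp [hb']))
      (addr_pred_lt hw)
    refine ⟨R', 2 + 2 + t + 2, Exec.while_ne (by rw [read_r (by decide)]; exact h50) (h1.seq h2)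
      hloop, ?_, ?_, h23', h50', fun a ha hb hc => ?_⟩
    · simp only [List.length_cons]; omega
    · have : j - 1 - (bs.length + 1) = j - (bs.length + 1 + 1) := by omega
      simp only [List.length_cons]; rw [h20', this]
    · rw [hR' a ha hb hc]; simp [ha, hb, hc]

/-- **Skipping the header numeral**: the codes of the digits `bs` and the comma are consumed within
`6 |bs| + 8` steps; `SYM` ends on the comma. [folklore] -/
theorem skipBits_exec {H R : ℕ → ℕ} {BOT j : ℕ} (hBOT : 100 ≤ BOT) (bs : List Bool)
    (h20 : R 20 = BOT + κ * j) (hst : StreamAt H BOT κ j ((bs.map fun b => C.cd (.bit b)) ++ [C.comma]))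
    (hsep : ∀ b ∈ bs, C.cd (.bit b) ≠ C.comma) (hw : BOT + κ * j < 2 ^ w) (qs : List (List ℕ)) :
    ∃ (R' : ℕ → ℕ) (t : ℕ), Exec w O (skipBits C κ) ⟨merge R H, qs⟩ ⟨merge R' H, qs⟩ t ∧
      t ≤ 6 * bs.length + 8 ∧ R' 20 = BOT + κ * (j - (bs.length + 1)) ∧ R' 23 = C.comma ∧
      R' 50 = 0 ∧ ∀ a, a ≠ 20 → a ≠ 23 → a ≠ 50 → R' a = R a := by
  have h0 : Exec w O (block [(.band, r 50, im 1, im 1)]) ⟨merge R H, qs⟩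
      ⟨merge (Function.update R 50 1) H, qs⟩ 1 :=
    Exec.block' _ qs (by
      simp only [execOps_cons, execOps_nil, execOp, Operand.read, Operand.write,
        update_merge_of_lt _ _ (show 50 < 100 by decide), BinOp.eval_band, Nat.and_self])
  obtain ⟨R', t, hloop, ht, h20', h23', h50', hR'⟩ := skipLoop_exec (w := w) (O := O) hBOT qs bs
    (Function.update R 50 1) j (by simp) (by simp [h20]) hst hsep hw
  refine ⟨R', 1 + t, h0.seq hloop, by omega, h20', h23', h50', fun a ha hb hc => ?_⟩
  rw [hR' a ha hb hc]; simp [hc]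

/-! ### Binary values -/

/-- `Complexity.bitsToNat` inverts `Nat.bits` (which is Mathlib's `encodeNat`, digits least
significant first). [folklore] -/
theorem bitsToNat_bits (v : ℕ) : bitsToNat v.bits = v := by
  rw [← encodeNat_eq_natBits]; exact bitsToNat_encodeNat v

/-- **The digit loop.** From `V = v`, `PW = pw`, flag `T3 ≠ 0` and a stream holding the codes of
the digits `bs` and the comma, the loop ends with `V = v + pw · bitsToNat bs`, `PW = pw · 2^{|bs|+1}`,
`SYM` on the comma, within `10 (|bs| + 1) + 1` steps. [folklore] -/
theorem bitLoop_exec {H : ℕ → ℕ} {BOT : ℕ} (hBOT : 100 ≤ BOT) (hcb : C.comma ≠ C.b1)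
    (qs : List (List ℕ)) :
    ∀ (bs : List Bool) (R : ℕ → ℕ) (j v pw : ℕ), R 59 ≠ 0 → R 20 = BOT + κ * j → R 48 = v →
      R 49 = pw → StreamAt H BOT κ j ((bs.map fun b => C.cd (.bit b)) ++ [C.comma]) →
      (∀ b ∈ bs, C.cd (.bit b) ≠ C.comma) → (∀ b ∈ bs, (C.cd (.bit b) = C.b1 ↔ b = true)) →
      BOT + κ * j < 2 ^ w → v + pw * bitsToNat bs < 2 ^ w → pw * 2 ^ (bs.length + 1) < 2 ^ w →
      ∃ (R' : ℕ → ℕ) (t : ℕ), Exec w O (whilenz (r 59) (bitBody C κ)) ⟨merge R H, qs⟩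
          ⟨merge R' H, qs⟩ t ∧
        t ≤ 10 * (bs.length + 1) + 1 ∧ R' 20 = BOT + κ * (j - (bs.length + 1)) ∧
        R' 23 = C.comma ∧ R' 59 = 0 ∧ R' 48 = v + pw * bitsToNat bs ∧
        R' 49 = pw * 2 ^ (bs.length + 1) ∧
        ∀ a, a ≠ 20 → a ≠ 23 → a ≠ 59 → a ≠ 48 → a ≠ 49 → a ≠ 62 → R' a = R a
  | [], R, j, v, pw, h59, h20, h48, h49, hst, _, _, hw, hvw, hpw => by
    simp only [List.map_nil, List.nil_append, streamAt_cons] at hst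
    obtain ⟨hj, hc, -⟩ := hst
    simp only [bitsToNat_nil, mul_zero, add_zero] at hvw
    simp only [List.length_nil, zero_add, pow_one] at hpw
    have h1 := advance_exec (w := w) (O := O) (κ := κ) h20 hj hBOT hc hw qs
    set R₁ := Function.update (Function.update R 23 C.comma) 20 (BOT + κ * (j - 1)) with hR₁
    have h2 := tst_exec (w := w) (O := O) (H := H) (c := C.comma) (flag := 59) (s := C.comma)
      (R := R₁) (by decide) (by simp [hR₁]) qs
    rw [if_pos rfl] at h2
    set R₂ := Function.update R₁ 59 0 with hR₂
    have h3 : Exec w O (block [(.eq, r 62, r 23, im C.b1), (.mul, r 62, r 62, r 49),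
        (.add, r 48, r 48, r 62), (.add, r 49, r 49, r 49)]) ⟨merge R₂ H, qs⟩
        ⟨merge (Function.update (Function.update (Function.update R₂ 62 0) 48 v) 49 (2 * pw)) H,
          qs⟩ 4 := by
      refine Exec.block' _ qs ?_
      have h23 : R₂ 23 = C.comma := by simp [hR₂, hR₁]
      have h48' : R₂ 48 = v := by simp [hR₂, hR₁, h48]
      have h49' : R₂ 49 = pw := by simp [hR₂, hR₁, h49]
      simp only [execOps_cons, execOps_nil, execOp, Operand.read, Operand.write,
        merge_apply_of_lt (show 23 < 100 by decide), merge_apply_of_lt (show 62 < 100 by decide),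
        merge_apply_of_lt (show 48 < 100 by decide), merge_apply_of_lt (show 49 < 100 by decide),
        update_merge_of_lt _ _ (show 62 < 100 by decide), update_merge_of_lt _ _ (show 48 < 100 by decide),
        update_merge_of_lt _ _ (show 49 < 100 by decide), Function.update_self,
        Function.update_of_ne (show (48 : ℕ) ≠ 62 by decide), Function.update_of_ne (show (49 : ℕ) ≠ 62 by decide),
        Function.update_of_ne (show (49 : ℕ) ≠ 48 by decide),
        h23, h48', h49', BinOp.eval_eq, if_neg hcb, Function.update_idem]
      rw [BinOp.eval_mul_of_lt (by simp), zero_mul,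
        BinOp.eval_add_of_lt (by simpa using hvw), add_zero, BinOp.eval_add_of_lt (by omega), ← two_mul]
    refine ⟨_, (2 + (2 + 4)) + 1 + 2, Exec.while_ne (by rw [read_r (by decide)]; exact h59)
      (h1.seqs_cons (h2.seqs_cons h3.seqs_one)) (Exec.while_zero (by rw [read_r (by decide)]; simp [hR₂])),
      by simp, by simp [hR₂, hR₁], by simp [hR₂, hR₁], by simp [hR₂, hR₁], by simp,
      by simp; ring, fun a ha hb hc hd he hf => by simp [hR₂, hR₁, ha, hb, hc, hd, he, hf]⟩
  | b :: bs, R, j, v, pw, h59, h20, h48, h49, hst, hsep, hb1, hw, hvw, hpw => by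
    simp only [List.map_cons, List.cons_append, streamAt_cons] at hst
    obtain ⟨hj, hc, hrest⟩ := hst
    have hne : C.cd (.bit b) ≠ C.comma := hsep b (by simp)
    have hbb : (if C.cd (.bit b) = C.b1 then 1 else 0) = b.toNat := by
      by_cases h : C.cd (.bit b) = C.b1
      · rw [if_pos h, (hb1 b (by simp)).1 h]; rfl
      · rw [if_neg h]
        cases b
        · rfl
        · exact absurd rfl h
    have hpw2 : 2 * pw * 2 ^ (bs.length + 1) = pw * 2 ^ ((b :: bs).length + 1) := by
      simp only [List.length_cons, pow_succ]; ring
    have hpw' : 2 * pw < 2 ^ w := by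
      have : 1 ≤ 2 ^ (bs.length + 1) := Nat.one_le_two_pow
      nlinarith
    have hbv : b.toNat * pw ≤ pw * bitsToNat (b :: bs) := by
      rw [mul_comm, bitsToNat_cons]; exact Nat.mul_le_mul_left _ (Nat.le_add_right _ _)
    have h1 := advance_exec (w := w) (O := O) (κ := κ) h20 hj hBOT hc hw qs
    set R₁ := Function.update (Function.update R 23 (C.cd (.bit b))) 20 (BOT + κ * (j - 1)) with hR₁
    have h2 := tst_exec (w := w) (O := O) (H := H) (c := C.comma) (flag := 59) (s := C.cd (.bit b))
      (R := R₁) (by decide) (by simp [hR₁]) qs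
    rw [if_neg hne] at h2
    set R₂ := Function.update R₁ 59 1 with hR₂
    have h3 : Exec w O (block [(.eq, r 62, r 23, im C.b1), (.mul, r 62, r 62, r 49),
        (.add, r 48, r 48, r 62), (.add, r 49, r 49, r 49)]) ⟨merge R₂ H, qs⟩
        ⟨merge (Function.update (Function.update (Function.update R₂ 62 (b.toNat * pw)) 48
          (v + b.toNat * pw)) 49 (2 * pw)) H, qs⟩ 4 := by
      refine Exec.block' _ qs ?_
      have h23 : R₂ 23 = C.cd (.bit b) := by simp [hR₂, hR₁]
      have h48' : R₂ 48 = v := by simp [hR₂, hR₁, h48]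
      have h49' : R₂ 49 = pw := by simp [hR₂, hR₁, h49]
      simp only [execOps_cons, execOps_nil, execOp, Operand.read, Operand.write,
        merge_apply_of_lt (show 23 < 100 by decide), merge_apply_of_lt (show 62 < 100 by decide),
        merge_apply_of_lt (show 48 < 100 by decide), merge_apply_of_lt (show 49 < 100 by decide),
        update_merge_of_lt _ _ (show 62 < 100 by decide), update_merge_of_lt _ _ (show 48 < 100 by decide),
        update_merge_of_lt _ _ (show 49 < 100 by decide), Function.update_self,
        Function.update_of_ne (show (48 : ℕ) ≠ 62 by decide), Function.update_of_ne (show (49 : ℕ) ≠ 62 by decide),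
        Function.update_of_ne (show (49 : ℕ) ≠ 48 by decide),
        h23, h48', h49', BinOp.eval_eq, hbb, Function.update_idem]
      rw [BinOp.eval_mul_of_lt (lt_of_le_of_lt (by cases b <;> simp : b.toNat * pw ≤ pw) (by omega)),
        BinOp.eval_add_of_lt (by nlinarith), BinOp.eval_add_of_lt (by omega), ← two_mul]
    set R₃ := Function.update (Function.update (Function.update R₂ 62 (b.toNat * pw)) 48
      (v + b.toNat * pw)) 49 (2 * pw) with hR₃
    obtain ⟨R', t, hloop, ht, h20', h23', h59', h48'', h49'', hR'⟩ := bitLoop_exec hBOT hcb qs bs R₃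
      (j - 1) (v + b.toNat * pw) (2 * pw) (by simp [hR₃, hR₂]) (by simp [hR₃, hR₂, hR₁])
      (by simp [hR₃]) (by simp [hR₃]) hrest (fun b' hb' => hsep b' (by simp [hb']))
      (fun b' hb' => hb1 b' (by simp [hb'])) (addr_pred_lt hw)
      (by simp only [bitsToNat_cons] at hvw; nlinarith) (by rw [hpw2]; exact hpw)
    refine ⟨R', (2 + (2 + 4)) + t + 2, Exec.while_ne (by rw [read_r (by decide)]; exact h59)
      (h1.seqs_cons (h2.seqs_cons h3.seqs_one)) hloop, ?_, ?_, h23', h59', ?_, ?_,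
      fun a ha hb hc hd he hf => ?_⟩
    · simp only [List.length_cons]; omega
    · have : j - 1 - (bs.length + 1) = j - (bs.length + 1 + 1) := by omega
      simp only [List.length_cons]; rw [h20', this]
    · rw [h48'']; simp only [bitsToNat_cons]; ring
    · rw [h49'', ← hpw2]
    · rw [hR' a ha hb hc hd he hf]; simp [hR₃, hR₂, hR₁, ha, hb, hc, hd, he, hf]

/-- The code of a polarity / digit symbol read as a bit. [folklore] -/
theorem ite_cd_eq_b1 {b : Bool} (h : C.cd (.bit b) = C.b1 ↔ b = true) :
    (if C.cd (.bit b) = C.b1 then 1 else 0) = b.toNat := by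
  by_cases hb : C.cd (.bit b) = C.b1
  · rw [if_pos hb, h.1 hb]; rfl
  · rw [if_neg hb]
    cases b
    · rfl
    · exact absurd rfl hb

/-- **One literal.** With `SYM` on the polarity code of `l` and the stream holding the digits of
`l.1` and the comma, `litCore` appends `litWord l` to the output and updates the counters and
maxima, within `10 |bits l.1| + 29` steps; `SYM` ends on the comma. [folklore] -/
theorem litCore_exec {G R : ℕ → ℕ} {BOT e₀ j : ℕ} {ys : List ℕ} (hBOT : 100 ≤ BOT)
    (hcb : C.comma ≠ C.b1) (he : 100 ≤ e₀) (l : ℕ × Bool) (h23 : R 23 = C.cd (.bit l.2))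
    (hpol : C.cd (.bit l.2) = C.b1 ↔ l.2 = true) (h20 : R 20 = BOT + κ * j)
    (hst : StreamAt G BOT κ j ((l.1.bits.map fun b => C.cd (.bit b)) ++ [C.comma]))
    (hsep : ∀ b ∈ l.1.bits, C.cd (.bit b) ≠ C.comma)
    (hb1 : ∀ b ∈ l.1.bits, (C.cd (.bit b) = C.b1 ↔ b = true)) (h40 : R 40 = e₀ + ys.length)
    (hje : BOT + κ * j < e₀) (hw : e₀ + ys.length + 1 < 2 ^ w)
    (hpw : 2 ^ (l.1.bits.length + 1) < 2 ^ w) (hlw : 2 * l.1 + 1 < 2 ^ w) (hcnt : R 46 + 1 < 2 ^ w)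
    (qs : List (List ℕ)) :
    ∃ (R' : ℕ → ℕ) (t : ℕ), Exec w O (litCore C κ) ⟨merge R (outMem G e₀ ys), qs⟩
        ⟨merge R' (outMem G e₀ (ys ++ [litWord l])), qs⟩ t ∧
      t ≤ 10 * l.1.bits.length + 29 ∧ R' 20 = BOT + κ * (j - (l.1.bits.length + 1)) ∧
      R' 23 = C.comma ∧ R' 40 = e₀ + ys.length + 1 ∧ R' 46 = R 46 + 1 ∧
      R' 42 = max (R 42) (l.1 + 1) ∧ R' 44 = max (R 44) (litWord l) ∧
      ∀ a, a ∉ [20, 23, 40, 42, 44, 46, 47, 48, 49, 59, 62, 63] → R' a = R a := by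
  have hew : e₀ < 2 ^ w := by omega
  have hjw : BOT + κ * j < 2 ^ w := lt_trans hje hew
  -- 1. polarity and initialisation
  set R₁ : ℕ → ℕ := Function.update (Function.update (Function.update (Function.update R 47 l.2.toNat)
    48 0) 49 1) 59 1 with hR₁
  have h1 : Exec w O (block [(.eq, r 47, r 23, im C.b1), (.band, r 48, im 0, im 0),
      (.band, r 49, im 1, im 1), (.band, r 59, im 1, im 1)]) ⟨merge R (outMem G e₀ ys), qs⟩
      ⟨merge R₁ (outMem G e₀ ys), qs⟩ 4 := by
    refine Exec.block' _ qs ?_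
    simp only [execOps_cons, execOps_nil, execOp, Operand.read, Operand.write,
      merge_apply_of_lt (show 23 < 100 by decide), update_merge_of_lt _ _ (show 47 < 100 by decide),
      update_merge_of_lt _ _ (show 48 < 100 by decide), update_merge_of_lt _ _ (show 49 < 100 by decide),
      update_merge_of_lt _ _ (show 59 < 100 by decide), h23, BinOp.eval_eq, ite_cd_eq_b1 hpol,
      BinOp.eval_band, Nat.and_self, hR₁]
  -- 2. the digits
  obtain ⟨R₂, t₂, h2, ht₂, h20₂, h23₂, h59₂, h48₂, h49₂, hR₂⟩ := bitLoop_exec (w := w) (O := O) hBOT hcb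
    qs l.1.bits R₁ j 0 1 (by simp [hR₁]) (by simp [hR₁, h20]) (by simp [hR₁]) (by simp [hR₁])
    (hst.outMem hje ys) hsep hb1 hjw (by rw [bitsToNat_bits]; omega) (by rwa [one_mul])
  rw [bitsToNat_bits, zero_add, one_mul] at h48₂
  rw [one_mul] at h49₂
  have h40₂ : R₂ 40 = e₀ + ys.length := by
    rw [hR₂ 40 (by decide) (by decide) (by decide) (by decide) (by decide) (by decide)]; simp [hR₁, h40]
  have h47₂ : R₂ 47 = l.2.toNat := by
    rw [hR₂ 47 (by decide) (by decide) (by decide) (by decide) (by decide) (by decide)]; simp [hR₁]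
  have h46₂ : R₂ 46 = R 46 := by
    rw [hR₂ 46 (by decide) (by decide) (by decide) (by decide) (by decide) (by decide)]; simp [hR₁]
  -- 3. the word
  set R₃ : ℕ → ℕ := Function.update (Function.update (Function.update (Function.update R₂ 62
    (litWord l)) 40 (e₀ + ys.length + 1)) 46 (R 46 + 1)) 63 (l.1 + 1) with hR₃
  have hl2 : l.2.toNat ≤ 1 := Bool.toNat_le _
  have hlw' : l.1 + l.1 + l.2.toNat < 2 ^ w := by omega
  have hlit : l.1 + l.1 + l.2.toNat = litWord l := by unfold litWord; ring
  have h3 : Exec w O (block [(.add, r 62, r 48, r 48), (.add, r 62, r 62, r 47), (.div, pt 40, r 62, im 1),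
      (.add, r 40, r 40, im 1), (.add, r 46, r 46, im 1), (.add, r 63, r 48, im 1)])
      ⟨merge R₂ (outMem G e₀ ys), qs⟩ ⟨merge R₃ (outMem G e₀ (ys ++ [litWord l])), qs⟩ 6 := by
    refine Exec.block' _ qs ?_
    simp (disch := first | decide | omega) only [execOps_cons, execOps_nil, execOp, Operand.read,
      Operand.write, merge_apply_of_lt, update_merge_of_lt, update_merge_of_le, Function.update_self,
      Function.update_of_ne, h48₂, h47₂, h40₂, h46₂, BinOp.eval_div_one, BinOp.eval_add_of_lt,
      outMem_snoc, hlit, hR₃, Function.update_idem]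
  -- 4./5. the maxima
  obtain ⟨t₄, ht₄, h4⟩ := maxInto_exec (w := w) (O := O) (R := R₃) (H := outMem G e₀ (ys ++ [litWord l]))
    (dst := 42) (src := 63) (s := 59) (by decide) (by decide) (by decide) (by decide) (by decide) qs
  set R₄ : ℕ → ℕ := Function.update (Function.update R₃ 59 (if R₃ 42 < R₃ 63 then 1 else 0)) 42
    (max (R₃ 42) (R₃ 63)) with hR₄
  obtain ⟨t₅, ht₅, h5⟩ := maxInto_exec (w := w) (O := O) (R := R₄) (H := outMem G e₀ (ys ++ [litWord l]))
    (dst := 44) (src := 62) (s := 59) (by decide) (by decide) (by decide) (by decide) (by decide) qs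
  have h42₃ : R₃ 42 = R 42 := by
    simp only [hR₃]
    rw [Function.update_of_ne (by decide), Function.update_of_ne (by decide),
      Function.update_of_ne (by decide), Function.update_of_ne (by decide),
      hR₂ 42 (by decide) (by decide) (by decide) (by decide) (by decide) (by decide)]
    simp [hR₁]
  have h44₄ : R₄ 44 = R 44 := by
    simp only [hR₄, hR₃]
    rw [Function.update_of_ne (by decide), Function.update_of_ne (by decide),
      Function.update_of_ne (by decide), Function.update_of_ne (by decide),
      Function.update_of_ne (by decide), Function.update_of_ne (by decide),
      hR₂ 44 (by decide) (by decide) (by decide) (by decide) (by decide) (by decide)]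
    simp [hR₁]
  have h63₃ : R₃ 63 = l.1 + 1 := by simp [hR₃]
  have h62₄ : R₄ 62 = litWord l := by simp [hR₄, hR₃]
  refine ⟨_, 4 + (t₂ + (6 + (t₄ + t₅))),
    h1.seqs_cons (h2.seqs_cons (h3.seqs_cons (h4.seqs_cons (Exec.seqs_one h5)))), by omega,
    ?_, ?_, ?_, ?_, ?_, ?_, ?_⟩
  · simp [hR₄, hR₃, h20₂]
  · simp [hR₄, hR₃, h23₂]
  · simp [hR₄, hR₃]
  · simp [hR₄, hR₃]
  · rw [Function.update_of_ne (by decide), Function.update_of_ne (by decide), hR₄, Function.update_self,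
      h42₃, h63₃]
  · rw [Function.update_self, h44₄, h62₄]
  · intro a ha
    simp only [List.mem_cons, List.not_mem_nil, or_false, not_or] at ha
    obtain ⟨h20a, h23a, h40a, h42a, h44a, h46a, h47a, h48a, h49a, h59a, h62a, h63a⟩ := ha
    simp only [hR₄, hR₃, Function.update_of_ne h44a, Function.update_of_ne h59a,
      Function.update_of_ne h42a, Function.update_of_ne h63a, Function.update_of_ne h46a,
      Function.update_of_ne h40a, Function.update_of_ne h62a,
      hR₂ a h20a h23a h59a h48a h49a h62a, hR₁, Function.update_of_ne h49a,
      Function.update_of_ne h48a, Function.update_of_ne h47a]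

/-! ### Separation of codes -/

/-- `C.Sep piece`: the code map separates every symbol of `piece` from every other symbol. (At the
top level: the symbols that occur in the simulated machine's output lie in its working alphabet, on
which the numbering is injective.) [folklore] -/
def PCodes.Sep (C : PCodes) (piece : List Γ') : Prop := ∀ γ ∈ piece, ∀ ξ, C.cd ξ = C.cd γ → ξ = γ

/-- Separation passes to sublists given as subsets. [folklore] -/
theorem PCodes.Sep.mono {C : PCodes} {p q : List Γ'} (h : C.Sep q) (hpq : ∀ γ ∈ p, γ ∈ q) : C.Sep p :=
  fun γ hγ => h γ (hpq γ hγ)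

/-- Separation of an append. [folklore] -/
theorem PCodes.sep_append {C : PCodes} {p q : List Γ'} : C.Sep (p ++ q) ↔ C.Sep p ∧ C.Sep q := by
  simp only [PCodes.Sep, List.mem_append]
  exact ⟨fun h => ⟨fun γ hγ => h γ (Or.inl hγ), fun γ hγ => h γ (Or.inr hγ)⟩,
    fun h γ hγ => hγ.elim (h.1 γ) (h.2 γ)⟩

/-- Separation of a cons. [folklore] -/
theorem PCodes.sep_cons {C : PCodes} {γ : Γ'} {q : List Γ'} :
    C.Sep (γ :: q) ↔ (∀ ξ, C.cd ξ = C.cd γ → ξ = γ) ∧ C.Sep q := by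
  rw [← List.singleton_append, PCodes.sep_append]
  simp [PCodes.Sep]

/-- A separated digit is not read as the comma. [folklore] -/
theorem PCodes.Sep.bit_ne_comma {C : PCodes} {bs : List Bool} (h : C.Sep (bs.map Γ'.bit)) :
    ∀ b ∈ bs, C.cd (.bit b) ≠ C.comma := fun b hb heq =>
  absurd (h (.bit b) (List.mem_map.2 ⟨b, hb, rfl⟩) .comma heq.symm) (by simp)

/-- A separated digit is read correctly. [folklore] -/
theorem PCodes.Sep.bit_iff {C : PCodes} {bs : List Bool} (h : C.Sep (bs.map Γ'.bit)) :
    ∀ b ∈ bs, (C.cd (.bit b) = C.b1 ↔ b = true) := fun b hb =>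
  ⟨fun heq => by
    have := h (.bit b) (List.mem_map.2 ⟨b, hb, rfl⟩) (.bit true) heq.symm
    simpa using this.symm, fun hb' => by subst hb'; rfl⟩

/-! ### Time bounds -/

/-- Time of one literal in the literal loop. [folklore] -/
def litTimeP (l : ℕ × Bool) : ℕ := 10 * l.1.bits.length + 37

/-- Time of the literals of a clause. [folklore] -/
def clauseLitTime : List (ℕ × Bool) → ℕ
  | [] => 0
  | l :: ls => litTimeP l + clauseLitTime ls

/-- Time of the clauses of a formula in the clause loop. [folklore] -/
def clausesTime : List (List (ℕ × Bool)) → ℕ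
  | [] => 0
  | c :: cs => clauseLitTime c + 29 + clausesTime cs

/-- Time of one formula. [folklore] -/
def formulaTime {k : ℕ} (ψ : KCNF k) : ℕ := 6 * ψ.numVars.bits.length + 17 + clausesTime ψ.clauses

/-- The number of empty clauses. [folklore] -/
def emptyCount : List (List (ℕ × Bool)) → ℕ
  | [] => 0
  | c :: cs => (if c = [] then 1 else 0) + emptyCount cs

/-- The empty-clause count is positive iff there is an empty clause. [folklore] -/
theorem emptyCount_ne_zero_iff : ∀ {cs : List (List (ℕ × Bool))}, emptyCount cs ≠ 0 ↔ [] ∈ cs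
  | [] => by simp [emptyCount]
  | c :: cs => by
    rw [emptyCount, List.mem_cons]
    have ih := @emptyCount_ne_zero_iff cs
    by_cases hc : c = []
    · simp [hc]
    · simp [hc, Ne.symm hc, ih]

/-- The empty-clause count is at most the number of clauses. [folklore] -/
theorem emptyCount_le : ∀ cs : List (List (ℕ × Bool)), emptyCount cs ≤ cs.length
  | [] => le_rfl
  | c :: cs => by
    have := emptyCount_le cs
    rw [emptyCount, List.length_cons]; split_ifs <;> omega

/-- The codes of a literal: polarity, digits, comma. [folklore] -/
theorem map_cd_encodeLiteral (l : ℕ × Bool) :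
    (KCNF.encodeLiteral l).map C.cd =
      C.cd (.bit l.2) :: ((l.1.bits.map fun b => C.cd (.bit b)) ++ [C.comma]) := by
  simp [KCNF.encodeLiteral, encodeNat_eq_natBits, Function.comp_def]

/-- **The literal loop of a clause.** With flag `T2 ≠ 0` and the stream holding the codes of the
literals `c` and the closing bracket, the loop appends the literal words of `c`, within
`clauseLitTime c + 8` steps; `SYM` ends on `ket`. [folklore] -/
theorem litLoop_exec {G : ℕ → ℕ} {BOT e₀ : ℕ} (hBOT : 100 ≤ BOT) (he : 100 ≤ e₀)
    (qs : List (List ℕ)) :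
    ∀ (c : List (ℕ × Bool)) (ys : List ℕ) (R : ℕ → ℕ) (j : ℕ), R 51 ≠ 0 → R 20 = BOT + κ * j →
      StreamAt G BOT κ j ((c.flatMap KCNF.encodeLiteral ++ [Γ'.ket]).map C.cd) →
      C.Sep (c.flatMap KCNF.encodeLiteral ++ [Γ'.ket]) →
      R 40 = e₀ + ys.length → BOT + κ * j < e₀ → e₀ + ys.length + c.length + 1 < 2 ^ w →
      (∀ l ∈ c, 2 ^ (l.1.bits.length + 1) < 2 ^ w) → (∀ l ∈ c, 2 * l.1 + 1 < 2 ^ w) →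
      R 46 + c.length < 2 ^ w →
      ∃ (R' : ℕ → ℕ) (t : ℕ), Exec w O (whilenz (r 51) (litBody C κ)) ⟨merge R (outMem G e₀ ys), qs⟩
          ⟨merge R' (outMem G e₀ (ys ++ c.map litWord)), qs⟩ t ∧
        t ≤ clauseLitTime c + 8 ∧
        R' 20 = BOT + κ * (j - (c.flatMap KCNF.encodeLiteral ++ [Γ'.ket]).length) ∧
        R' 23 = C.ket ∧ R' 51 = 0 ∧ R' 40 = e₀ + ys.length + c.length ∧ R' 46 = R 46 + c.length ∧
        R' 42 = max (R 42) (lmax (c.map fun l => l.1 + 1)) ∧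
        R' 44 = max (R 44) (lmax (c.map litWord)) ∧
        ∀ a, a ∉ [20, 23, 40, 42, 44, 46, 47, 48, 49, 51, 59, 62, 63] → R' a = R a
  | [], ys, R, j, h51, h20, hst, _, h40, hje, hw, _, _, _ => by
    simp only [List.flatMap_nil, List.nil_append, List.map_cons, List.map_nil, streamAt_cons] at hst
    obtain ⟨hj, hc, -⟩ := hst
    have hjw : BOT + κ * j < 2 ^ w := by omega
    have h1 := advance_exec (w := w) (O := O) (κ := κ) (H := outMem G e₀ ys) (c := C.ket) h20 hj hBOT
      (by rw [outMem_of_lt _ _ (by nlinarith)]; exact hc) hjw qs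
    set R₁ := Function.update (Function.update R 23 C.ket) 20 (BOT + κ * (j - 1)) with hR₁
    have h2 := tst_exec (w := w) (O := O) (H := outMem G e₀ ys) (c := C.ket) (flag := 51) (s := C.ket)
      (R := R₁) (by decide) (by simp [hR₁]) qs
    rw [if_pos rfl] at h2
    refine ⟨_, (2 + (2 + (0 + 1))) + 1 + 2, Exec.while_ne (by rw [read_r (by decide)]; exact h51)
      (h1.seqs_cons (h2.seqs_cons (Exec.seqs_one (Exec.ifz_zero (by rw [read_r (by decide)]; simp)
        (Exec.skip _)))))
      (by rw [List.map_nil, List.append_nil]; exact Exec.while_zero (by rw [read_r (by decide)]; simp)),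
      by simp [clauseLitTime], by simp [hR₁], by simp [hR₁], by simp, by simp [hR₁, h40], by simp [hR₁],
      by simp [hR₁, lmax], by simp [hR₁, lmax], fun a ha => ?_⟩
    simp only [List.mem_cons, List.not_mem_nil, or_false, not_or] at ha
    simp [hR₁, ha.1, ha.2.1, ha.2.2.2.2.2.2.2.2.2.1]
  | l :: c, ys, R, j, h51, h20, hst, hsep, h40, hje, hw, hpw, hlw, hcnt => by
    rw [List.flatMap_cons, List.append_assoc, List.map_append, map_cd_encodeLiteral] at hst
    simp only [List.cons_append, streamAt_cons] at hst
    obtain ⟨hj, hc, hrest⟩ := hst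
    rw [streamAt_append] at hrest
    obtain ⟨hbits, hrest⟩ := hrest
    rw [List.flatMap_cons, List.append_assoc, PCodes.sep_append] at hsep
    obtain ⟨hsepl, hsep⟩ := hsep
    have hsepl' := hsepl
    rw [KCNF.encodeLiteral, PCodes.sep_append, PCodes.sep_cons, encodeNat_eq_natBits] at hsepl'
    obtain ⟨⟨hpolsep, hbitsep⟩, hcommasep⟩ := hsepl'
    have hpol : C.cd (.bit l.2) = C.b1 ↔ l.2 = true :=
      ⟨fun heq => by have := hpolsep (.bit true) heq.symm; simpa using this.symm,
        fun h => by rw [h]; rfl⟩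
    have hcb : C.comma ≠ C.b1 := fun heq => by
      have := hcommasep .comma (by simp) (.bit true) heq.symm; simp at this
    have hlk : C.cd (.bit l.2) ≠ C.ket := fun heq => by
      have := hpolsep .ket heq.symm; simp at this
    have hjw : BOT + κ * j < 2 ^ w := by omega
    -- fetch and test
    have h1 := advance_exec (w := w) (O := O) (κ := κ) (H := outMem G e₀ ys) (c := C.cd (.bit l.2)) h20 hj
      hBOT (by rw [outMem_of_lt _ _ (by nlinarith)]; exact hc) hjw qs
    set R₁ := Function.update (Function.update R 23 (C.cd (.bit l.2))) 20 (BOT + κ * (j - 1)) with hR₁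
    have h2 := tst_exec (w := w) (O := O) (H := outMem G e₀ ys) (c := C.ket) (flag := 51)
      (s := C.cd (.bit l.2)) (R := R₁) (by decide) (by simp [hR₁]) qs
    rw [if_neg hlk] at h2
    set R₂ := Function.update R₁ 51 1 with hR₂
    -- the literal
    obtain ⟨R₃, t₃, h3, ht₃, h20₃, h23₃, h40₃, h46₃, h42₃, h44₃, hR₃⟩ := litCore_exec (w := w) (O := O)
      (G := G) (R := R₂) (ys := ys) hBOT hcb he l (by simp [hR₂, hR₁]) hpol (by simp [hR₂, hR₁]) hbits
      hbitsep.bit_ne_comma hbitsep.bit_iff (by simp [hR₂, hR₁, h40])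
      (lt_of_le_of_lt (Nat.add_le_add_left (Nat.mul_le_mul_left κ (Nat.sub_le j 1)) BOT) hje)
      (by simp at hw; omega) (hpw l (by simp)) (hlw l (by simp)) (by simp [hR₂, hR₁]; simp at hcnt; omega) qs
    -- the remaining literals
    have hlen : (List.map (fun b => C.cd (Γ'.bit b)) l.1.bits ++ [C.comma]).length = l.1.bits.length + 1 := by
      simp
    rw [hlen] at hrest
    obtain ⟨R', t', h4, ht', h20', h23', h51', h40', h46', h42', h44', hR'⟩ := litLoop_exec hBOT he qs c
      (ys ++ [litWord l]) R₃ (j - 1 - (l.1.bits.length + 1))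
      (by rw [hR₃ 51 (by decide)]; simp [hR₂]) h20₃ hrest hsep (by simp [h40₃, Nat.add_assoc])
      (lt_of_le_of_lt (Nat.add_le_add_left (Nat.mul_le_mul_left κ (by omega)) BOT) hje)
      (by simp at hw ⊢; omega) (fun l' hl' => hpw l' (by simp [hl'])) (fun l' hl' => hlw l' (by simp [hl']))
      (by rw [h46₃]; simp [hR₂, hR₁]; simp at hcnt; omega)
    have e4 : ys ++ [litWord l] ++ List.map litWord c = ys ++ List.map litWord (l :: c) := by simp
    rw [e4] at h4
    refine ⟨R', (2 + (2 + (t₃ + 2))) + t' + 2, Exec.while_ne (by rw [read_r (by decide)]; exact h51)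
      (h1.seqs_cons (h2.seqs_cons (Exec.seqs_one (Exec.ifz_ne (by rw [read_r (by decide)]; simp [hR₂]) h3))))
      h4, ?_, ?_, h23', h51', ?_, ?_, ?_, ?_, fun a ha => ?_⟩
    · simp only [clauseLitTime, litTimeP]; omega
    · rw [h20']; congr 2
      simp only [List.flatMap_cons, List.length_append, List.length_cons, KCNF.encodeLiteral,
        List.length_map, List.length_nil, encodeNat_eq_natBits]
      omega
    · rw [h40']; simp only [List.length_append, List.length_cons, List.length_nil]; omega
    · rw [h46', h46₃]; simp [hR₂, hR₁]; omega
    · rw [h42', h42₃]; simp [hR₂, hR₁, lmax, max_assoc]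
    · rw [h44', h44₃]; simp [hR₂, hR₁, lmax, max_assoc]
    · simp only [List.mem_cons, List.not_mem_nil, or_false, not_or] at ha
      rw [hR' a (by simp [ha]), hR₃ a (by simp [ha])]
      simp [hR₂, hR₁, ha.1, ha.2.1, ha.2.2.2.2.2.2.2.2.2.1]

/-- Writing inside the output region. [folklore] -/
theorem outMem_set (G : ℕ → ℕ) (e₀ : ℕ) {zs : List ℕ} {i : ℕ} (hi : i < zs.length) (v : ℕ) :
    Function.update (outMem G e₀ zs) (e₀ + i) v = outMem G e₀ (zs.set i v) := by
  funext a
  by_cases ha : a = e₀ + i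
  · subst ha
    rw [Function.update_self, outMem_add G e₀ _ (by simpa using hi), List.getElem_set_self]
  · rw [Function.update_of_ne ha]
    unfold outMem
    simp only [List.length_set]
    split_ifs with h
    · rw [List.getD_eq_getElem _ _ (by omega), List.getD_eq_getElem _ _ (by rw [List.length_set]; omega),
        List.getElem_set_of_ne (by omega)]
    · rfl

/-- Back-patching the reserved length word of a clause. [folklore] -/
theorem outMem_patch (G : ℕ → ℕ) (e₀ : ℕ) (ys zs : List ℕ) (u v : ℕ) :
    Function.update (outMem G e₀ (ys ++ [u] ++ zs)) (e₀ + ys.length) v = outMem G e₀ (ys ++ [v] ++ zs) := by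
  rw [outMem_set G e₀ (by simp) v]
  congr 1
  rw [List.append_assoc, List.append_assoc, List.set_append_right _ _ (by simp), Nat.sub_self]
  rfl

/-- **One clause.** With the stream holding the codes of the literals of `c` and the closing
bracket, `clauseCore` appends the length word and the literal words of `c` (`KSatTranscoder.clauseWords [c]`),
counts the clause and — if `c` is empty — the empty clause, within `clauseLitTime c + 21` steps;
`SYM` ends on `ket`. [folklore] -/
theorem clauseCore_exec {G R : ℕ → ℕ} {BOT e₀ j : ℕ} {ys : List ℕ} (hBOT : 100 ≤ BOT) (he : 100 ≤ e₀)
    (c : List (ℕ × Bool)) (h20 : R 20 = BOT + κ * j)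
    (hst : StreamAt G BOT κ j ((c.flatMap KCNF.encodeLiteral ++ [Γ'.ket]).map C.cd))
    (hsep : C.Sep (c.flatMap KCNF.encodeLiteral ++ [Γ'.ket])) (h40 : R 40 = e₀ + ys.length)
    (hje : BOT + κ * j < e₀) (hw : e₀ + ys.length + c.length + 2 < 2 ^ w)
    (hpw : ∀ l ∈ c, 2 ^ (l.1.bits.length + 1) < 2 ^ w) (hlw : ∀ l ∈ c, 2 * l.1 + 1 < 2 ^ w)
    (h41 : R 41 + 1 < 2 ^ w) (h43 : R 43 + 1 < 2 ^ w) (qs : List (List ℕ)) :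
    ∃ (R' : ℕ → ℕ) (t : ℕ), Exec w O (clauseCore C κ) ⟨merge R (outMem G e₀ ys), qs⟩
        ⟨merge R' (outMem G e₀ (ys ++ (c.length :: c.map litWord))), qs⟩ t ∧
      t ≤ clauseLitTime c + 21 ∧
      R' 20 = BOT + κ * (j - (c.flatMap KCNF.encodeLiteral ++ [Γ'.ket]).length) ∧ R' 23 = C.ket ∧
      R' 40 = e₀ + ys.length + 1 + c.length ∧ R' 41 = R 41 + 1 ∧
      R' 43 = R 43 + (if c = [] then 1 else 0) ∧
      R' 42 = max (R 42) (lmax (c.map fun l => l.1 + 1)) ∧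
      R' 44 = max (R 44) (lmax (c.length :: c.map litWord)) ∧
      ∀ a, a ∉ [20, 23, 40, 41, 42, 43, 44, 45, 46, 47, 48, 49, 51, 59, 62, 63] → R' a = R a := by
  -- 1. reserve the length word
  set R₁ : ℕ → ℕ := Function.update (Function.update (Function.update (Function.update R 45
    (e₀ + ys.length)) 40 (e₀ + ys.length + 1)) 46 0) 51 1 with hR₁
  have h1 : Exec w O (block [(.div, r 45, r 40, im 1), (.band, pt 40, im 0, im 0), (.add, r 40, r 40, im 1),
      (.band, r 46, im 0, im 0), (.band, r 51, im 1, im 1)]) ⟨merge R (outMem G e₀ ys), qs⟩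
      ⟨merge R₁ (outMem G e₀ (ys ++ [0])), qs⟩ 5 := by
    refine Exec.block' _ qs ?_
    simp (disch := first | decide | omega) only [execOps_cons, execOps_nil, execOp, Operand.read,
      Operand.write, merge_apply_of_lt, update_merge_of_lt, update_merge_of_le,
      Function.update_of_ne, h40, BinOp.eval_div_one, BinOp.eval_add_of_lt, BinOp.eval_band,
      Nat.and_self, outMem_snoc, hR₁]
  -- 2. the literals
  obtain ⟨R₂, t₂, h2, ht₂, h20₂, h23₂, -, h40₂, h46₂, h42₂, h44₂, hR₂⟩ := litLoop_exec (w := w) (O := O)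
    (G := G) (e₀ := e₀) hBOT he qs c (ys ++ [0]) R₁ j (by simp [hR₁]) (by simp [hR₁, h20]) hst hsep
    (by simp [hR₁, Nat.add_assoc]) hje (by simp; omega) hpw hlw (by simp [hR₁]; omega)
  have h45₂ : R₂ 45 = e₀ + ys.length := by rw [hR₂ 45 (by decide)]; simp [hR₁]
  have h41₂ : R₂ 41 = R 41 := by rw [hR₂ 41 (by decide)]; simp [hR₁]
  have h43₂ : R₂ 43 = R 43 := by rw [hR₂ 43 (by decide)]; simp [hR₁]
  simp only [hR₁, Function.update_self, Function.update_of_ne (show (46 : ℕ) ≠ 51 by decide), zero_add]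
    at h46₂
  -- 3. back-patch, count
  set R₃ : ℕ → ℕ := Function.update (Function.update (Function.update R₂ 41 (R 41 + 1)) 59
    (if c.length = 0 then 1 else 0)) 43 (R 43 + (if c.length = 0 then 1 else 0)) with hR₃
  have h3 : Exec w O (block [(.div, pt 45, r 46, im 1), (.add, r 41, r 41, im 1), (.eq, r 59, r 46, im 0),
      (.add, r 43, r 43, r 59)]) ⟨merge R₂ (outMem G e₀ (ys ++ [0] ++ c.map litWord)), qs⟩
      ⟨merge R₃ (outMem G e₀ (ys ++ [c.length] ++ c.map litWord)), qs⟩ 4 := by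
    refine Exec.block' _ qs ?_
    have hb : R 43 + (if c.length = 0 then 1 else 0) < 2 ^ w := by split_ifs <;> omega
    simp (disch := first | decide | omega) only [execOps_cons, execOps_nil, execOp, Operand.read,
      Operand.write, merge_apply_of_lt, update_merge_of_lt, update_merge_of_le, Function.update_self,
      Function.update_of_ne, h45₂, h46₂, h41₂, h43₂, BinOp.eval_div_one, BinOp.eval_add_of_lt, BinOp.eval_eq,
      outMem_patch, hR₃]
  -- 4. the maximum with the length
  obtain ⟨t₄, ht₄, h4⟩ := maxInto_exec (w := w) (O := O) (R := R₃)
    (H := outMem G e₀ (ys ++ [c.length] ++ c.map litWord)) (dst := 44) (src := 46) (s := 59)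
    (by decide) (by decide) (by decide) (by decide) (by decide) qs
  have h44₃ : R₃ 44 = max (R 44) (lmax (c.map litWord)) := by
    simp only [hR₃]
    rw [Function.update_of_ne (by decide), Function.update_of_ne (by decide), Function.update_of_ne (by decide),
      h44₂]
    simp [hR₁]
  have h46₃ : R₃ 46 = c.length := by simp [hR₃, h46₂]
  have e : ys ++ [c.length] ++ c.map litWord = ys ++ (c.length :: c.map litWord) := by simp
  rw [e] at h4
  rw [e] at h3
  refine ⟨_, 5 + (t₂ + (4 + t₄)), h1.seqs_cons (h2.seqs_cons (h3.seqs_cons (Exec.seqs_one h4))), by omega,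
    ?_, ?_, ?_, ?_, ?_, ?_, ?_, fun a ha => ?_⟩
  · simp [hR₃, h20₂]
  · simp [hR₃, h23₂]
  · simp [hR₃, h40₂]; omega
  · simp [hR₃]
  · rw [Function.update_of_ne (by decide), Function.update_of_ne (by decide), hR₃, Function.update_self]
    simp only [List.length_eq_zero_iff]
  · rw [Function.update_of_ne (by decide), Function.update_of_ne (by decide), hR₃,
      Function.update_of_ne (by decide), Function.update_of_ne (by decide), Function.update_of_ne (by decide),
      h42₂]
    simp [hR₁]
  · rw [Function.update_self, h44₃, h46₃,
      show lmax (c.length :: c.map litWord) = max c.length (lmax (c.map litWord)) from rfl, max_assoc,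
      max_comm (lmax (c.map litWord))]
  · simp only [List.mem_cons, List.not_mem_nil, or_false, not_or] at ha
    obtain ⟨h20a, h23a, h40a, h41a, h42a, h43a, h44a, h45a, h46a, h47a, h48a, h49a, h51a, h59a, h62a, h63a⟩ :=
      ha
    rw [Function.update_of_ne h44a, Function.update_of_ne h59a, hR₃, Function.update_of_ne h43a,
      Function.update_of_ne h59a, Function.update_of_ne h41a, hR₂ a (by simp [*])]
    simp [hR₁, h45a, h40a, h46a, h51a]

/-- The codes of a clause: bracket, literals, bracket. [folklore] -/
theorem encodeClause_eq (c : List (ℕ × Bool)) :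
    KCNF.encodeClause c = Γ'.bra :: (c.flatMap KCNF.encodeLiteral ++ [Γ'.ket]) := by
  simp [KCNF.encodeClause]

/-- `KSatTranscoder.clauseWords` of a cons, as an append of the words of the first clause. [folklore] -/
theorem length_clauseWords_cons (c : List (ℕ × Bool)) (cs : List (List (ℕ × Bool))) :
    (KSatTranscoder.clauseWords (c :: cs)).length = c.length + 1 + (KSatTranscoder.clauseWords cs).length := by
  rw [KSatTranscoder.clauseWords_cons]; simp; omega

/-- **The clause loop of a formula.** With flag `T ≠ 0` and the stream holding the codes of the
clauses `cs` and the blank, the loop appends `KSatTranscoder.clauseWords cs`, counting clauses and empty clauses and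
keeping the maxima, within `clausesTime cs + 8` steps; `SYM` ends on `blank`. [folklore] -/
theorem clauseLoop_exec {G : ℕ → ℕ} {BOT e₀ : ℕ} (hBOT : 100 ≤ BOT) (he : 100 ≤ e₀)
    (qs : List (List ℕ)) :
    ∀ (cs : List (List (ℕ × Bool))) (ys : List ℕ) (R : ℕ → ℕ) (j : ℕ), R 50 ≠ 0 →
      R 20 = BOT + κ * j → StreamAt G BOT κ j ((cs.flatMap KCNF.encodeClause ++ [Γ'.blank]).map C.cd) →
      C.Sep (cs.flatMap KCNF.encodeClause ++ [Γ'.blank]) →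
      R 40 = e₀ + ys.length → BOT + κ * j < e₀ → e₀ + ys.length + (KSatTranscoder.clauseWords cs).length + 1 < 2 ^ w →
      (∀ c ∈ cs, ∀ l ∈ c, 2 ^ (l.1.bits.length + 1) < 2 ^ w) → (∀ c ∈ cs, ∀ l ∈ c, 2 * l.1 + 1 < 2 ^ w) →
      R 41 + cs.length < 2 ^ w → R 43 + cs.length < 2 ^ w →
      ∃ (R' : ℕ → ℕ) (t : ℕ), Exec w O (whilenz (r 50) (clauseBody C κ)) ⟨merge R (outMem G e₀ ys), qs⟩
          ⟨merge R' (outMem G e₀ (ys ++ KSatTranscoder.clauseWords cs)), qs⟩ t ∧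
        t ≤ clausesTime cs + 8 ∧
        R' 20 = BOT + κ * (j - (cs.flatMap KCNF.encodeClause ++ [Γ'.blank]).length) ∧
        R' 23 = C.blank ∧ R' 50 = 0 ∧ R' 40 = e₀ + ys.length + (KSatTranscoder.clauseWords cs).length ∧
        R' 41 = R 41 + cs.length ∧ R' 43 = R 43 + emptyCount cs ∧
        R' 42 = max (R 42) (lmax (cs.flatten.map fun l => l.1 + 1)) ∧
        R' 44 = max (R 44) (lmax (KSatTranscoder.clauseWords cs)) ∧
        ∀ a, a ∉ [20, 23, 40, 41, 42, 43, 44, 45, 46, 47, 48, 49, 50, 51, 59, 62, 63] → R' a = R a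
  | [], ys, R, j, h50, h20, hst, _, h40, hje, hw, _, _, _, _ => by
    simp only [List.flatMap_nil, List.nil_append, List.map_cons, List.map_nil, streamAt_cons] at hst
    obtain ⟨hj, hc, -⟩ := hst
    have hjw : BOT + κ * j < 2 ^ w := by omega
    have h1 := advance_exec (w := w) (O := O) (κ := κ) (H := outMem G e₀ ys) (c := C.blank) h20 hj hBOT
      (by rw [outMem_of_lt _ _ (by nlinarith)]; exact hc) hjw qs
    set R₁ := Function.update (Function.update R 23 C.blank) 20 (BOT + κ * (j - 1)) with hR₁
    have h2 := tst_exec (w := w) (O := O) (H := outMem G e₀ ys) (c := C.blank) (flag := 50) (s := C.blank)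
      (R := R₁) (by decide) (by simp [hR₁]) qs
    rw [if_pos rfl] at h2
    refine ⟨_, (2 + (2 + (0 + 1))) + 1 + 2, Exec.while_ne (by rw [read_r (by decide)]; exact h50)
      (h1.seqs_cons (h2.seqs_cons (Exec.seqs_one (Exec.ifz_zero (by rw [read_r (by decide)]; simp)
        (Exec.skip _)))))
      (by rw [show KSatTranscoder.clauseWords [] = [] from rfl, List.append_nil]
          exact Exec.while_zero (by rw [read_r (by decide)]; simp)),
      by simp [clausesTime], by simp [hR₁], by simp [hR₁], by simp, by simp [hR₁, h40, KSatTranscoder.clauseWords],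
      by simp [hR₁], by simp [hR₁, emptyCount], by simp [hR₁, lmax], by simp [hR₁, lmax, KSatTranscoder.clauseWords],
      fun a ha => ?_⟩
    simp only [List.mem_cons, List.not_mem_nil, or_false, not_or] at ha
    simp [hR₁, ha.1, ha.2.1, ha.2.2.2.2.2.2.2.2.2.2.2.2.1]
  | c :: cs, ys, R, j, h50, h20, hst, hsep, h40, hje, hw, hpw, hlw, h41, h43 => by
    rw [List.flatMap_cons, encodeClause_eq, List.append_assoc] at hst hsep
    simp only [List.cons_append, List.map_cons, streamAt_cons] at hst
    obtain ⟨hj, hc, hrest⟩ := hst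
    rw [List.map_append, streamAt_append] at hrest
    obtain ⟨hcl, hrest⟩ := hrest
    rw [PCodes.sep_append, PCodes.sep_cons] at hsep
    obtain ⟨⟨hbrasep, hsepc⟩, hsep⟩ := hsep
    have hbk : C.bra ≠ C.blank := fun heq => by
      have := hbrasep .blank (by simpa using heq.symm); simp at this
    have hjw : BOT + κ * j < 2 ^ w := by omega
    rw [length_clauseWords_cons] at hw
    -- fetch and test
    have h1 := advance_exec (w := w) (O := O) (κ := κ) (H := outMem G e₀ ys) (c := C.bra) h20 hj hBOT
      (by rw [outMem_of_lt _ _ (by nlinarith)]; exact hc) hjw qs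
    set R₁ := Function.update (Function.update R 23 C.bra) 20 (BOT + κ * (j - 1)) with hR₁
    have h2 := tst_exec (w := w) (O := O) (H := outMem G e₀ ys) (c := C.blank) (flag := 50) (s := C.bra)
      (R := R₁) (by decide) (by simp [hR₁]) qs
    rw [if_neg hbk] at h2
    set R₂ := Function.update R₁ 50 1 with hR₂
    -- the clause
    obtain ⟨R₃, t₃, h3, ht₃, h20₃, h23₃, h40₃, h41₃, h43₃, h42₃, h44₃, hR₃⟩ := clauseCore_exec (w := w) (O := O)
      (G := G) (R := R₂) (ys := ys) hBOT he c (by simp [hR₂, hR₁]) hcl hsepc (by simp [hR₂, hR₁, h40])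
      (lt_of_le_of_lt (Nat.add_le_add_left (Nat.mul_le_mul_left κ (Nat.sub_le j 1)) BOT) hje)
      (by omega) (fun l hl => hpw c (by simp) l hl) (fun l hl => hlw c (by simp) l hl)
      (by simp [hR₂, hR₁]; simp at h41; omega) (by simp [hR₂, hR₁]; simp at h43; omega) qs
    -- the remaining clauses
    rw [List.length_map] at hrest
    obtain ⟨R', t', h4, ht', h20', h23', h50', h40', h41', h43', h42', h44', hR'⟩ := clauseLoop_exec hBOT he qs
      cs (ys ++ (c.length :: c.map litWord)) R₃ (j - 1 - (c.flatMap KCNF.encodeLiteral ++ [Γ'.ket]).length)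
      (by rw [hR₃ 50 (by decide)]; simp [hR₂]) h20₃ hrest hsep (by simp [h40₃]; omega)
      (lt_of_le_of_lt (Nat.add_le_add_left (Nat.mul_le_mul_left κ (by omega)) BOT) hje)
      (by simp; omega) (fun c' hc' => hpw c' (by simp [hc'])) (fun c' hc' => hlw c' (by simp [hc']))
      (by rw [h41₃]; simp [hR₂, hR₁]; simp at h41; omega)
      (by rw [h43₃]; simp [hR₂, hR₁]; simp at h43; split_ifs <;> omega)
    have e4 : ys ++ (c.length :: c.map litWord) ++ KSatTranscoder.clauseWords cs = ys ++ KSatTranscoder.clauseWords (c :: cs) := by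
      rw [KSatTranscoder.clauseWords_cons, List.append_assoc]
    rw [e4] at h4
    refine ⟨R', (2 + (2 + (t₃ + 2))) + t' + 2, Exec.while_ne (by rw [read_r (by decide)]; exact h50)
      (h1.seqs_cons (h2.seqs_cons (Exec.seqs_one (Exec.ifz_ne (by rw [read_r (by decide)]; simp [hR₂]) h3))))
      h4, ?_, ?_, h23', h50', ?_, ?_, ?_, ?_, ?_, fun a ha => ?_⟩
    · simp only [clausesTime]; omega
    · rw [h20']; congr 2
      simp only [List.flatMap_cons, encodeClause_eq, List.length_append, List.length_cons, List.length_nil]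
      omega
    · rw [h40', length_clauseWords_cons]
      simp only [List.length_append, List.length_cons, List.length_map]; omega
    · rw [h41', h41₃]; simp [hR₂, hR₁]; omega
    · rw [h43', h43₃]; simp [hR₂, hR₁, emptyCount]; omega
    · rw [h42', h42₃]; simp [hR₂, hR₁, lmax_append, max_assoc, List.flatten_cons]
    · rw [h44', h44₃, KSatTranscoder.clauseWords_cons, lmax_append]; simp [hR₂, hR₁, max_assoc]
    · simp only [List.mem_cons, List.not_mem_nil, or_false, not_or] at ha
      rw [hR' a (by simp [ha]), hR₃ a (by simp [ha])]
      simp [hR₂, hR₁, ha.1, ha.2.1, ha.2.2.2.2.2.2.2.2.2.2.2.2.1]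

/-- **One formula.** On a stream holding the codes of `ψ.encode ++ [blank]`, `formulaP` appends
`KSatTranscoder.clauseWords ψ.clauses` to the output and adds the number of clauses, of empty clauses, and the
maxima `numVars` / largest word to the registers `41, 43, 42, 44`, within `formulaTime ψ` steps;
the address register ends `|ψ.encode| + 1` cells further down. [folklore] -/
theorem formulaP_exec {k : ℕ} {G R : ℕ → ℕ} {BOT e₀ j : ℕ} {ys : List ℕ} (hBOT : 100 ≤ BOT)
    (he : 100 ≤ e₀) (ψ : KCNF k) (h20 : R 20 = BOT + κ * j)
    (hst : StreamAt G BOT κ j ((ψ.encode ++ [Γ'.blank]).map C.cd)) (hsep : C.Sep (ψ.encode ++ [Γ'.blank]))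
    (h40 : R 40 = e₀ + ys.length) (hje : BOT + κ * j < e₀)
    (hw : e₀ + ys.length + (KSatTranscoder.clauseWords ψ.clauses).length + 1 < 2 ^ w)
    (hpw : ∀ c ∈ ψ.clauses, ∀ l ∈ c, 2 ^ (l.1.bits.length + 1) < 2 ^ w)
    (hlw : ∀ c ∈ ψ.clauses, ∀ l ∈ c, 2 * l.1 + 1 < 2 ^ w) (h41 : R 41 + ψ.clauses.length < 2 ^ w)
    (h43 : R 43 + ψ.clauses.length < 2 ^ w) (qs : List (List ℕ)) :
    ∃ (R' : ℕ → ℕ) (t : ℕ), Exec w O (formulaP C κ) ⟨merge R (outMem G e₀ ys), qs⟩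
        ⟨merge R' (outMem G e₀ (ys ++ KSatTranscoder.clauseWords ψ.clauses)), qs⟩ t ∧
      t ≤ formulaTime ψ ∧ R' 20 = BOT + κ * (j - (ψ.encode.length + 1)) ∧ R' 23 = C.blank ∧ R' 50 = 0 ∧
      R' 40 = e₀ + ys.length + (KSatTranscoder.clauseWords ψ.clauses).length ∧ R' 41 = R 41 + ψ.clauses.length ∧
      R' 43 = R 43 + emptyCount ψ.clauses ∧ R' 42 = max (R 42) (CNF.numVars ψ.clauses) ∧
      R' 44 = max (R 44) (lmax (KSatTranscoder.clauseWords ψ.clauses)) ∧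
      ∀ a, a ∉ [20, 23, 40, 41, 42, 43, 44, 45, 46, 47, 48, 49, 50, 51, 59, 62, 63] → R' a = R a := by
  have hsplit : (ψ.encode ++ [Γ'.blank]).map C.cd = ((ψ.numVars.bits.map fun b => C.cd (.bit b)) ++ [C.comma]) ++
      (ψ.clauses.flatMap KCNF.encodeClause ++ [Γ'.blank]).map C.cd := by
    simp [KCNF.encode, encodeNat_eq_natBits, Function.comp_def]
  rw [hsplit, streamAt_append] at hst
  obtain ⟨hhdr, hrest⟩ := hst
  rw [KCNF.encode, List.append_assoc, PCodes.sep_append, List.cons_append, PCodes.sep_cons,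
    encodeNat_eq_natBits] at hsep
  obtain ⟨hbitsep, -, hsep⟩ := hsep
  have hjw : BOT + κ * j < 2 ^ w := by omega
  -- 1. the header
  obtain ⟨R₁, t₁, h1, ht₁, h20₁, -, -, hR₁⟩ := skipBits_exec (w := w) (O := O) (H := outMem G e₀ ys)
    (R := R) hBOT ψ.numVars.bits h20 (hhdr.outMem hje ys) hbitsep.bit_ne_comma hjw qs
  -- 2. the flag
  have h2 : Exec w O (block [(.band, r 50, im 1, im 1)]) ⟨merge R₁ (outMem G e₀ ys), qs⟩
      ⟨merge (Function.update R₁ 50 1) (outMem G e₀ ys), qs⟩ 1 :=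
    Exec.block' _ qs (by
      simp only [execOps_cons, execOps_nil, execOp, Operand.read, Operand.write,
        update_merge_of_lt _ _ (show 50 < 100 by decide), BinOp.eval_band, Nat.and_self])
  -- 3. the clauses
  have hlen : ((ψ.numVars.bits.map fun b => C.cd (.bit b)) ++ [C.comma]).length = ψ.numVars.bits.length + 1 := by
    simp
  rw [hlen] at hrest
  obtain ⟨R', t', h3, ht', h20', h23', h50', h40', h41', h43', h42', h44', hR'⟩ := clauseLoop_exec (w := w)
    (O := O) (G := G) hBOT he qs ψ.clauses ys (Function.update R₁ 50 1) (j - (ψ.numVars.bits.length + 1))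
    (by simp) (by simp [h20₁]) hrest hsep (by simp [hR₁ 40 (by decide) (by decide) (by decide), h40])
    (lt_of_le_of_lt (Nat.add_le_add_left (Nat.mul_le_mul_left κ (Nat.sub_le _ _)) BOT) hje) hw hpw hlw
    (by simp [hR₁ 41 (by decide) (by decide) (by decide)]; exact h41)
    (by simp [hR₁ 43 (by decide) (by decide) (by decide)]; exact h43)
  refine ⟨R', t₁ + (1 + t'), h1.seqs_cons (h2.seqs_cons (Exec.seqs_one h3)), ?_, ?_, h23', h50', h40', ?_, ?_, ?_,
    ?_, fun a ha => ?_⟩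
  · simp only [formulaTime]; omega
  · rw [h20']; congr 2
    simp only [KCNF.encode, List.length_append, List.length_cons, List.length_map, List.length_nil,
      encodeNat_eq_natBits]
    omega
  · rw [h41']; simp [hR₁ 41 (by decide) (by decide) (by decide)]
  · rw [h43']; simp [hR₁ 43 (by decide) (by decide) (by decide)]
  · rw [h42']; simp [hR₁ 42 (by decide) (by decide) (by decide), CNF.numVars, lmax, List.map_flatten]
  · rw [h44']; simp [hR₁ 44 (by decide) (by decide) (by decide)]
  · simp only [List.mem_cons, List.not_mem_nil, or_false, not_or] at ha
    rw [hR' a (by simp [ha])]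
    simp [ha.2.2.2.2.2.2.2.2.2.2.2.2.1, hR₁ a ha.1 ha.2.1 ha.2.2.2.2.2.2.2.2.2.2.2.2.1]

/-! ### The time of the parser is linear in the length of the string -/

/-- The literal loop takes at most `19` steps per symbol. [folklore] -/
theorem clauseLitTime_le : ∀ c : List (ℕ × Bool),
    clauseLitTime c ≤ 19 * (c.flatMap KCNF.encodeLiteral).length
  | [] => by simp [clauseLitTime]
  | l :: c => by
    have ih := clauseLitTime_le c
    simp only [clauseLitTime, litTimeP, List.flatMap_cons, List.length_append, KCNF.encodeLiteral,
      List.length_cons, List.length_map, encodeNat_eq_natBits, List.length_nil]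
    omega

/-- The clause loop takes at most `19` steps per symbol. [folklore] -/
theorem clausesTime_le : ∀ cs : List (List (ℕ × Bool)),
    clausesTime cs ≤ 19 * (cs.flatMap KCNF.encodeClause).length
  | [] => by simp [clausesTime]
  | c :: cs => by
    have ih := clausesTime_le cs
    have hc := clauseLitTime_le c
    simp only [clausesTime, List.flatMap_cons, List.length_append, encodeClause_eq, List.length_cons,
      List.length_nil]
    omega

/-- **The parser is linear time**: at most `19` steps per symbol of `ψ.encode ++ [blank]`.
[folklore] -/
theorem formulaTime_le {k : ℕ} (ψ : KCNF k) : formulaTime ψ ≤ 19 * (ψ.encode.length + 1) := by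
  have h := clausesTime_le ψ.clauses
  simp only [formulaTime, KCNF.encode, List.length_append, List.length_cons, List.length_map,
    encodeNat_eq_natBits]
  omega

end exec

end Literature.Computability.FineGrained.SerfRed
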